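import Literature.MathematicalPhysics.KineticTheory.LangevinChainHormander
import Literature.MathematicalPhysics.KineticTheory.PhaseSpacePoisson
import HarnessLib

/-!
# Open chains: the total energy current is a time derivative (`{H, X} = J`)

`Literature/Barriers/AtomisticToContinuum/` (D-0021 barrier catalogue), sub-problem `FouriersLaw`.
Chain-level companion of the barrier audit of `MazurBoundBallistic` (2026-08-15; sharpened block
in `MazurBoundBallisticNarrow.lean`). Conjunct (4) of `MazurBoundBallisticNarrow` says, for a
contraction semigroup `U t` on a real Hilbert space: an observable that is a time derivative
along the dynamics (`∫₀^τ U t A dt = U τ X - X`) has zero projection on the conserved vectors —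
zero Drude weight, every Mazur bound silent — and a BOUNDED Green–Kubo integral
`|∫₀^τ ⟪U t A, A⟫ dt| ≤ 2‖X‖‖A‖`. This file proves, in the tree's own encoding of the
Bonetto–Lebowitz–Rey-Bellet chain (`OscillatorChain`: positions in `ℝ^N`, FREE ends, unit masses,
`hamiltonian`, `generator`, `bondCurrent` of `FouriersLaw.lean`; Poisson bracket `poisson` of
`PhaseSpacePoisson.lean`), that the total energy current of every finite open chain IS such a
derivative at the level of the generator:

* `poisson_hamiltonian_energyMoment`: `{H, X} = ∑_i j_{i,i+1}` for the energy first moment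
  `X = ∑_k k·h_k` (`energyMoment`; site energies with the bond energies split evenly), for EVERY
  chain with differentiable `U, V` and every `N` — the local energy balance
  `ḣ_k = j_{k-1,k} - j_{k,k+1}` summed by parts, the boundary currents being absent at free ends;
* `generator_energyMoment`: with the baths switched off (`γ = 0`) the generator of
  `FouriersLaw.lean` IS `{H, ·}` (`generator_eq_poisson_of_gamma_eq_zero`), so `L X = J`;
* `pinnedChain_generator_energyMoment`: in particular for the conjunct's chain with its baths
  removed, `pinnedChain ω₂ lam β 0`, for ALL real `ω₂, lam, β` — the harmonic corner
  `lam = β = 0` (ballistic between baths, companion `HarmonicCrystalBallistic`) and the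
  anharmonic bulk alike.

Consequently the catalogued corollary `Mazur1969_inequality.tendsto_integral_atTop` ("one
conserved `Q` with `⟪J, Q⟫ ≠ 0` makes the Green–Kubo integral diverge linearly") has no instance
`A = J` on the isolated bulk of the tree's bath geometry at any finite `N`, for any interaction:
there `⟪J, Q⟫ = ⟪LX, Q⟫ = 0` for every conserved `Q` (conjunct (4)). Its instances live on rings
(periodic boundary conditions: with the bond `(N-1, 0)` present the same summation by parts
leaves `J = Ẋ + N·j_{N-1,0}`, and no choice of origin removes the defect) or in infinite volume —
which is where the printed uses of Mazur's bound (periodic Toda chain, Zotos 2002; harmonic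
ring) take place. Printed counterpart (quantum, `Ĵ = i[X̂, Ĥ]` with the position operator
`X̂ = ∑_j j n̂_j`): "for systems with open boundary conditions, it can be shown that the
coefficient of the zero frequency delta peak is identically zero for any finite system,
regardless of its integrability" [Rigol–Shastry 2008, Abstract; p. 2].

## Scope

Pointwise identities between functions on `PhaseSpace N`; no flow, semigroup or invariant
measure is constructed, so the passage from `L X = J` to the mild coboundary form
`∫₀^τ U t J = U τ X - X` on `L²(μ)` (fundamental theorem of calculus along the Hamiltonian flow,
`X, J ∈ L²(μ)` for polynomial potentials and a Gibbs measure) stays informal, as in the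
catalogued entry's dictionary.
-/

noncomputable section

open Finset
open scoped BigOperators

namespace Literature.Barriers.AtomisticToContinuum.OpenChain

open Literature.MathematicalPhysics.KineticTheory.HeatConduction
open Literature.MathematicalPhysics.KineticTheory.HeatConduction.OscillatorChain

variable (P : OscillatorChain) {N : ℕ}

/-- The first moment of the energy `X = ∑_k k·h_k` of the free-end chain, with the site energies
`h_k = p_k²/2 + U(q_k) + ½V(q_{k+1} - q_k) + ½V(q_k - q_{k-1})` (bond energies split evenly;
boundary bonds absent), written as `∑_k k (p_k²/2 + U(q_k)) + ∑_{l = k+1} (k + ½) V(q_l - q_k)`.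
[folklore] -/
def energyMoment (N : ℕ) (x : PhaseSpace N) : ℝ :=
  (∑ k : Fin N, (k.val : ℝ) * (x.2 k ^ 2 / 2 + P.U (x.1 k))) +
    ∑ k : Fin N, ∑ l : Fin N,
      if l.val = k.val + 1 then ((k.val : ℝ) + 1 / 2) * P.V (x.1 l - x.1 k) else 0

/-- `∂_{p_i} X = i · p_i`. [folklore] -/
theorem partialP_energyMoment (i : Fin N) (x : PhaseSpace N) :
    partialP i (energyMoment P N) x = (i.val : ℝ) * x.2 i := by
  unfold partialP energyMoment
  have h1 : HasDerivAt (fun t : ℝ => ∑ k : Fin N,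
      (k.val : ℝ) * ((Function.update x.2 i t k) ^ 2 / 2 + P.U (x.1 k)))
      (∑ k : Fin N, if k = i then (i.val : ℝ) * x.2 i else 0) (x.2 i) := by
    apply HasDerivAt.fun_sum
    intro k _
    by_cases hk : k = i
    · subst hk
      simp only [Function.update_self, if_true]
      have h' : HasDerivAt (fun t : ℝ => t ^ 2 / 2 + P.U (x.1 k)) (x.2 k) (x.2 k) := by
        have h := ((hasDerivAt_pow 2 (x.2 k)).div_const 2).add_const (P.U (x.1 k))
        have he : ((2 : ℕ) : ℝ) * x.2 k ^ (2 - 1) / 2 = x.2 k := by norm_num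
        rwa [he] at h
      exact h'.const_mul _
    · simp only [Function.update_of_ne hk, hk, if_false]
      exact hasDerivAt_const _ _
  have h2 : HasDerivAt (fun _ : ℝ => ∑ k : Fin N, ∑ l : Fin N,
      if l.val = k.val + 1 then ((k.val : ℝ) + 1 / 2) * P.V (x.1 l - x.1 k) else 0) 0 (x.2 i) :=
    hasDerivAt_const _ _
  have h := h1.add h2
  simp only [Finset.sum_ite_eq', Finset.mem_univ, if_true, add_zero] at h
  exact h.deriv

/-- Closed form of `∂_{q_i} X`:
`i·U'(q_i) + ∑_{l = k+1} (k + ½) V'(q_l - q_k) ([l = i] - [k = i])`. [folklore] -/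
def dEnergyMoment (N : ℕ) (i : Fin N) (q : Fin N → ℝ) : ℝ :=
  (i.val : ℝ) * deriv P.U (q i) + ∑ k : Fin N, ∑ l : Fin N,
    if l.val = k.val + 1 then
      ((k.val : ℝ) + 1 / 2) * deriv P.V (q l - q k) *
        ((if l = i then 1 else 0) - (if k = i then 1 else 0)) else 0

/-- `∂_{q_i} X = dEnergyMoment` for differentiable potentials. [folklore] -/
theorem partialQ_energyMoment (hU : Differentiable ℝ P.U) (hV : Differentiable ℝ P.V)
    (i : Fin N) (x : PhaseSpace N) :
    partialQ i (energyMoment P N) x = dEnergyMoment P N i x.1 := by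
  unfold partialQ energyMoment dEnergyMoment
  have h1 : HasDerivAt (fun t : ℝ => ∑ k : Fin N,
      (k.val : ℝ) * (x.2 k ^ 2 / 2 + P.U (Function.update x.1 i t k)))
      (∑ k : Fin N, if k = i then (i.val : ℝ) * deriv P.U (x.1 i) else 0) (x.1 i) := by
    apply HasDerivAt.fun_sum
    intro k _
    by_cases hk : k = i
    · subst hk
      simp only [Function.update_self, if_true]
      exact (((hU _).hasDerivAt).const_add _).const_mul _
    · simp only [Function.update_of_ne hk, hk, if_false]
      exact hasDerivAt_const _ _
  have h2 : HasDerivAt (fun t : ℝ => ∑ k : Fin N, ∑ l : Fin N,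
      if l.val = k.val + 1 then ((k.val : ℝ) + 1 / 2) * P.V (Function.update x.1 i t l -
        Function.update x.1 i t k) else 0)
      (∑ k : Fin N, ∑ l : Fin N, if l.val = k.val + 1 then
        ((k.val : ℝ) + 1 / 2) * deriv P.V (x.1 l - x.1 k) *
          ((if l = i then 1 else 0) - (if k = i then 1 else 0)) else 0) (x.1 i) := by
    refine HasDerivAt.fun_sum fun k _ => HasDerivAt.fun_sum fun l _ => ?_
    by_cases hlk : l.val = k.val + 1
    · simp only [hlk, if_true]
      have ha : HasDerivAt (fun t => Function.update x.1 i t l - Function.update x.1 i t k)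
          ((if l = i then 1 else 0) - (if k = i then 1 else 0)) (x.1 i) := by
        refine HasDerivAt.sub ?_ ?_
        · by_cases hl : l = i
          · subst hl; simp only [Function.update_self, if_true]; exact hasDerivAt_id _
          · simp only [Function.update_of_ne hl, hl, if_false]; exact hasDerivAt_const _ _
        · by_cases hk : k = i
          · subst hk; simp only [Function.update_self, if_true]; exact hasDerivAt_id _
          · simp only [Function.update_of_ne hk, hk, if_false]; exact hasDerivAt_const _ _
      have hcomp := ((hV _).hasDerivAt).comp (x.1 i) ha
      have heval : Function.update x.1 i (x.1 i) l - Function.update x.1 i (x.1 i) k =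
          x.1 l - x.1 k := by simp
      rw [heval] at hcomp
      have := hcomp.const_mul ((k.val : ℝ) + 1 / 2)
      rw [← mul_assoc] at this
      exact this
    · simp only [hlk, if_false]
      exact hasDerivAt_const _ _
  have h := h1.add h2
  simp only [Finset.sum_ite_eq', Finset.mem_univ, if_true] at h
  exact h.deriv

/-- **`{H, X} = J` on the free-end chain**: the Poisson bracket of the Hamiltonian with the
energy first moment is the total current `∑_i j_{i,i+1}` (BLR's bond currents
`j_i = -½(p_i + p_{i+1})V'(q_{i+1} - q_i)`), for every chain with differentiable potentials and
every `N` — the local energy balance `ḣ_i = j_{i-1,i} - j_{i,i+1}` summed by parts, the boundary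
currents being absent at free ends. [folklore] -/
theorem poisson_hamiltonian_energyMoment (hU : Differentiable ℝ P.U) (hV : Differentiable ℝ P.V)
    (N : ℕ) (x : PhaseSpace N) :
    poisson (P.hamiltonian N) (energyMoment P N) x = ∑ i : Fin N, P.bondCurrent N i x := by
  unfold poisson
  simp only [P.partialP_hamiltonian, P.partialQ_hamiltonian_eq_dPotential hU hV,
    partialP_energyMoment P, partialQ_energyMoment P hU hV]
  -- pointwise form of the summand: the pinning terms cancel, the bond terms combine
  have key : ∀ i : Fin N,
      x.2 i * dEnergyMoment P N i x.1 - P.dPotential N i x.1 * ((i.val : ℝ) * x.2 i) =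
        ∑ k : Fin N, ∑ l : Fin N, if l.val = k.val + 1 then
          x.2 i * deriv P.V (x.1 l - x.1 k) * (((k.val : ℝ) + 1 / 2 - i.val) *
            ((if l = i then 1 else 0) - (if k = i then 1 else 0))) else 0 := by
    intro i
    unfold dEnergyMoment OscillatorChain.dPotential
    set A := ∑ k : Fin N, ∑ l : Fin N, (if l.val = k.val + 1 then
      ((k.val : ℝ) + 1 / 2) * deriv P.V (x.1 l - x.1 k) *
        ((if l = i then 1 else 0) - (if k = i then 1 else 0)) else 0) with hA
    set B := ∑ k : Fin N, ∑ l : Fin N, (if l.val = k.val + 1 then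
      deriv P.V (x.1 l - x.1 k) * ((if l = i then 1 else 0) - (if k = i then 1 else 0))
        else 0) with hB
    have h1 : x.2 i * ((i.val : ℝ) * deriv P.U (x.1 i) + A) -
        (deriv P.U (x.1 i) + B) * ((i.val : ℝ) * x.2 i) =
          x.2 i * A - ((i.val : ℝ) * x.2 i) * B := by ring
    rw [h1, hA, hB, Finset.mul_sum, Finset.mul_sum, ← Finset.sum_sub_distrib]
    refine Finset.sum_congr rfl fun k _ => ?_
    rw [Finset.mul_sum, Finset.mul_sum, ← Finset.sum_sub_distrib]
    refine Finset.sum_congr rfl fun l _ => ?_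
    split_ifs <;> ring
  simp only [key]
  -- exchange the sums: `∑_i ∑_k ∑_l = ∑_k ∑_l ∑_i`
  rw [Finset.sum_comm]
  refine Finset.sum_congr rfl fun k _ => ?_
  rw [Finset.sum_comm]
  unfold OscillatorChain.bondCurrent
  refine Finset.sum_congr rfl fun l _ => ?_
  rw [Finset.sum_ite_irrel, Finset.sum_const_zero]
  split_ifs with hlk
  · -- `∑_i p_i V'_{kl} (k + ½ - i)([l = i] - [k = i]) = -½ (p_k + p_l) V'_{kl}`
    have hl : ((l.val : ℕ) : ℝ) = (k.val : ℝ) + 1 := by exact_mod_cast hlk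
    simp only [mul_sub, Finset.sum_sub_distrib, mul_ite, mul_one, mul_zero,
      Finset.sum_ite_eq, Finset.mem_univ, if_true]
    rw [hl]
    ring
  · rfl

/-- The Hamiltonian part of the tree's generator is the Poisson bracket with `H`: for a chain
with `γ = 0` (baths switched off — the ISOLATED free-end chain),
`L f = ∑_i (p_i ∂_{q_i} f - ∂_{q_i}H ∂_{p_i} f) = {H, f}`. [folklore] -/
theorem generator_eq_poisson_of_gamma_eq_zero (hγ : P.γ = 0) (N : ℕ) (T_L T_R : ℝ)
    (f : PhaseSpace N → ℝ) (x : PhaseSpace N) :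
    P.generator N T_L T_R f x = poisson (P.hamiltonian N) f x := by
  unfold OscillatorChain.generator poisson
  simp only [hγ, zero_mul, add_zero, P.partialP_hamiltonian]

/-- **The isolated free-end chain's current is `L X`**: with the baths switched off (`γ = 0`),
the generator of `FouriersLaw.lean` applied to the energy first moment `X = ∑ k·h_k` is the
total current `∑_i j_{i,i+1}`, for every differentiable `U, V`, every `N` (and any nominal
`T_L, T_R`). Along the Hamiltonian flow `J = dX/dt`: the total current of a finite OPEN chain is
a time derivative, so (given the Koopman semigroup on `L²` of an invariant measure) it satisfies
the coboundary hypothesis `∫₀^τ U t J dt = U τ X - X` of `MazurBoundBallisticNarrow` conjunct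
(4) — zero Drude weight and a bounded Green–Kubo integral at every `N`, whatever the interaction
("identically zero for any finite system, regardless of its integrability", the quantum form
`Ĵ = i[X̂, Ĥ]`). [cite: RigolShastry2008, Abstract and p. 2] -/
theorem generator_energyMoment (hγ : P.γ = 0) (hU : Differentiable ℝ P.U)
    (hV : Differentiable ℝ P.V) (N : ℕ) (T_L T_R : ℝ) (x : PhaseSpace N) :
    P.generator N T_L T_R (energyMoment P N) x = ∑ i : Fin N, P.bondCurrent N i x := by
  rw [generator_eq_poisson_of_gamma_eq_zero P hγ, poisson_hamiltonian_energyMoment P hU hV]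

/-- The conjunct's chain with its baths switched off: for `pinnedChain ω₂ lam β 0` (pinning
`ω₂q²/2 + lam q⁴/4`, coupling `r²/2 + βr⁴/4`, ANY real `ω₂, lam, β` — harmonic corner
`lam = β = 0` and anharmonic bulk alike) the generator maps the energy first moment to the total
current: `L X = J` at every `N`. [folklore] -/
theorem pinnedChain_generator_energyMoment (ω₂ lam β : ℝ) (N : ℕ) (T_L T_R : ℝ)
    (x : PhaseSpace N) :
    (pinnedChain ω₂ lam β 0).generator N T_L T_R (energyMoment (pinnedChain ω₂ lam β 0) N) x =
      ∑ i : Fin N, (pinnedChain ω₂ lam β 0).bondCurrent N i x :=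
  generator_energyMoment _ rfl
    ((pinnedChain_contDiff_U ω₂ lam β 0 (n := 1)).differentiable one_ne_zero)
    ((pinnedChain_contDiff_V ω₂ lam β 0 (n := 1)).differentiable one_ne_zero) N T_L T_R x

/-- `J = {H, X}` pointwise: the total current of the free-end chain is the Liouville derivative
of the energy first moment (symmetric restatement of `poisson_hamiltonian_energyMoment`).
[folklore] -/
theorem sum_bondCurrent_eq_poisson (hU : Differentiable ℝ P.U) (hV : Differentiable ℝ P.V)
    (N : ℕ) (x : PhaseSpace N) :
    ∑ i : Fin N, P.bondCurrent N i x = poisson (P.hamiltonian N) (energyMoment P N) x :=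
  (poisson_hamiltonian_energyMoment P hU hV N x).symm

end Literature.Barriers.AtomisticToContinuum.OpenChain

end
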